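import Summits.RiemannHypothesis.RiemannHypothesis.Theorems.WeilWindowFlowWindowLipschitzStubSurplusCalculusAux

/-!
# Stub `stub_surplusCalculus` of line `borderline-barrier`
(crux `WeilWindowFlow.WindowLipschitz`, item stmt-RiemannHypothesis-1039)

Pure one-variable calculus: the surplus of the two-scale barrier profile
`W(s) = (log (1/s))^{-1/2}` is at least `¼ √(log (1/d₀))` on the whole edge layer
`0 < d < d₀ ≤ d₁`, with the explicit (far from optimal) choice `d₁ = exp (-1000)`.

Notation in the comments: `L = log (1/d)`, `L₀ = log (1/d₀)`, `W(s) = 1/√(log (1/s))`,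
`f_d(s) = (W(d+s) − W(d)) / (2s)` (the integrand of the inner pull `J = ∫₀^{d₀−d} f_d`);
the four terms of the surplus are the killing term `K = W(d)(L/2 − 1) = ½√L − 1/√L`, the inner
pull `J`, the tiny term `β₀ d₀ = d₀/√L₀` and the plateau pull
`P = (1/√L₀ − 1/√L)(½ log(1/(d₀−d)) + 3)`.

## Proof sketch (the calculus facts are in the `Aux` file)

* if `2d ≤ d₀` (`stub_surplusCalculus_pull₁`, `stub_surplusCalculus_plateau₁`):
  `J ≤ ∫₀^{d} f_d + ∫_d^{d₀} f_d ≤ ¼ + ½√L − √L₀ + L₀/(2√L) + 1` and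
  `P ≤ (1/√L₀ − 1/√L)(L₀/2 + 7/2) = ½√L₀ − L₀/(2√L) + (7/2)(1/√L₀ − 1/√L)`; the `½√L` and
  `L₀/(2√L)` terms cancel against `K` and the total is `≥ ½√L₀ − 21/4`;
* if `d₀ < 2d` (`stub_surplusCalculus_pull₂`, `stub_surplusCalculus_plateau₂`): `J ≤ ¼`,
  `P ≤ 3` (using `y log(1/y) ≤ d (L + 1)` for `0 < y ≤ d`), and `K ≥ ½√L₀ − 1`.

Since `√L₀ ≥ √1000 > 31`, both totals exceed `¼ √L₀`.
-/

set_option linter.dupNamespace false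

noncomputable section

open MeasureTheory Set Filter
open scoped Topology ENNReal NNReal

namespace Summit.RiemannHypothesis.RiemannHypothesis.Theorems.WeilWindowFlowWindowLipschitz

open Literature.NumberTheory.LFunctions

/-! ## The two cases -/

/-- The inner pull in the case `2d ≤ d₀`:
`J ≤ ½√L − √L₀ + L₀/(2√L) + 5/4` (head `≤ ¼`, tail by `stub_surplusCalculus_tail`,
`√(L − log 2) ≤ √L`, `√(L₀ − log 2) ≥ √L₀ − 1`). -/
theorem stub_surplusCalculus_pull₁ {d d₀ : ℝ} (hd : 0 < d) (h2d : 2 * d ≤ d₀)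
    (h2d₀ : 2 * d₀ < 1) (hL₀ : 1 ≤ Real.log (1 / d₀)) :
    (∫ s in (0 : ℝ)..(d₀ - d),
        (1 / Real.sqrt (Real.log (1 / (d + s))) - 1 / Real.sqrt (Real.log (1 / d))) / (2 * s)) ≤
      Real.sqrt (Real.log (1 / d)) / 2 - Real.sqrt (Real.log (1 / d₀))
        + Real.log (1 / d₀) / Real.sqrt (Real.log (1 / d)) / 2 + 5 / 4 := by
  have hdd₀ : d < d₀ := by linarith
  have hd₀pos : 0 < d₀ := hd.trans hdd₀
  have hd₀lt1 : d₀ < 1 := by linarith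
  have hlog2 := stub_surplusCalculus_log_two_le
  have hlog2pos : 0 < Real.log 2 := Real.log_pos one_lt_two
  have hL₀pos : 0 < Real.log (1 / d₀) := by linarith
  have hLL₀ : Real.log (1 / d₀) ≤ Real.log (1 / d) :=
    Real.log_le_log (by positivity) (one_div_le_one_div_of_le hd hdd₀.le)
  have hb1 : 1 ≤ Real.sqrt (Real.log (1 / d₀)) := Real.one_le_sqrt.2 hL₀
  have hX : 1 ≤ Real.log (1 / d₀) * Real.sqrt (Real.log (1 / d₀)) :=
    one_le_mul_of_one_le_of_one_le hL₀ hb1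
  -- integrability, monotonicity in the upper limit, splitting at `s = d`
  have hf_int0 := stub_surplusCalculus_intervalIntegrable hd le_rfl hd₀pos.le
    (by linarith : d + d₀ < 1)
  have hf_int1 := stub_surplusCalculus_intervalIntegrable hd le_rfl hd.le
    (by linarith : d + d < 1)
  have hf_int2 := stub_surplusCalculus_intervalIntegrable hd hd.le hdd₀.le
    (by linarith : d + d₀ < 1)
  have hnonneg : 0 ≤ᵐ[volume.restrict (Ioc 0 d₀)] (fun s : ℝ =>
      (1 / Real.sqrt (Real.log (1 / (d + s))) - 1 / Real.sqrt (Real.log (1 / d))) / (2 * s)) := by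
    refine ae_restrict_of_forall_mem measurableSet_Ioc fun s hs => ?_
    exact (stub_surplusCalculus_integrand_le hd hs.1.le le_rfl (by linarith [hs.2])).1
  have hJmono := intervalIntegral.integral_mono_interval (le_refl (0 : ℝ))
    (by linarith : (0 : ℝ) ≤ d₀ - d) (by linarith : d₀ - d ≤ d₀) hnonneg hf_int0
  have hsplit := intervalIntegral.integral_add_adjacent_intervals hf_int1 hf_int2
  -- head `≤ ¼`
  have hJ1 := stub_surplusCalculus_head hd hd.le (by linarith : d + d ≤ d₀) hd₀lt1
  have hJ1' : d / (4 * d * (Real.log (1 / d₀) * Real.sqrt (Real.log (1 / d₀)))) ≤ 1 / 4 := by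
    rw [show d / (4 * d * (Real.log (1 / d₀) * Real.sqrt (Real.log (1 / d₀)))) =
        1 / (4 * (Real.log (1 / d₀) * Real.sqrt (Real.log (1 / d₀)))) by field_simp]
    exact one_div_le_one_div_of_le (by norm_num) (by linarith)
  -- tail
  have hJ2 := stub_surplusCalculus_tail hd hdd₀.le h2d₀
  have hs1 : Real.sqrt (Real.log (1 / d) - Real.log 2) ≤ Real.sqrt (Real.log (1 / d)) :=
    Real.sqrt_le_sqrt (by linarith)
  have hs2 : Real.sqrt (Real.log (1 / d₀)) - 1 ≤ Real.sqrt (Real.log (1 / d₀) - Real.log 2) := by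
    rcases eq_or_lt_of_le hb1 with h | h
    · rw [← h]
      simp only [sub_self]
      exact Real.sqrt_nonneg _
    · rw [Real.le_sqrt' (by linarith)]
      nlinarith [Real.sq_sqrt hL₀pos.le]
  have hmid : (Real.log (1 / d) - Real.log (1 / d₀)) / (2 * Real.sqrt (Real.log (1 / d))) =
      Real.sqrt (Real.log (1 / d)) / 2
        - Real.log (1 / d₀) / Real.sqrt (Real.log (1 / d)) / 2 := by
    have e : (Real.log (1 / d) - Real.log (1 / d₀)) / (2 * Real.sqrt (Real.log (1 / d))) =
        Real.log (1 / d) / Real.sqrt (Real.log (1 / d)) / 2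
          - Real.log (1 / d₀) / Real.sqrt (Real.log (1 / d)) / 2 := by
      ring
    rw [e, Real.div_sqrt]
  linarith

/-- The plateau pull in the case `2d ≤ d₀`: `log(1/(d₀−d)) ≤ log 2 + L₀ ≤ 1 + L₀`, so
`(1/√L₀ − 1/√L)(½ log(1/(d₀−d)) + 3) ≤ (1/√L₀ − 1/√L)(L₀/2 + 7/2)`, expanded with
`L₀/√L₀ = √L₀`. -/
theorem stub_surplusCalculus_plateau₁ {d d₀ : ℝ} (hd : 0 < d) (h2d : 2 * d ≤ d₀) (hd₀ : d₀ < 1) :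
    (1 / Real.sqrt (Real.log (1 / d₀)) - 1 / Real.sqrt (Real.log (1 / d))) *
        (Real.log (1 / (d₀ - d)) / 2 + 3) ≤
      Real.sqrt (Real.log (1 / d₀)) / 2 + 7 / 2 * (1 / Real.sqrt (Real.log (1 / d₀)))
        - Real.log (1 / d₀) / Real.sqrt (Real.log (1 / d)) / 2
        - 7 / 2 * (1 / Real.sqrt (Real.log (1 / d))) := by
  have hdd₀ : d < d₀ := by linarith
  have hd₀pos : 0 < d₀ := hd.trans hdd₀
  have hlog2 := stub_surplusCalculus_log_two_le
  have hA := stub_surplusCalculus_diff_le hd hdd₀.le hd₀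
  have hQle : Real.log (1 / (d₀ - d)) / 2 + 3 ≤ Real.log (1 / d₀) / 2 + 7 / 2 := by
    have h1 : Real.log (1 / (d₀ - d)) ≤ Real.log (2 * (1 / d₀)) := by
      apply Real.log_le_log (by positivity)
      have e : 2 * (1 / d₀) = 1 / (d₀ / 2) := by field_simp
      rw [e]
      exact one_div_le_one_div_of_le (by positivity) (by linarith)
    have h2 : Real.log (2 * (1 / d₀)) = Real.log 2 + Real.log (1 / d₀) :=
      Real.log_mul two_ne_zero (one_div_pos.2 hd₀pos).ne'
    linarith
  have hP1 := mul_le_mul_of_nonneg_left hQle hA.1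
  have hP2 : (1 / Real.sqrt (Real.log (1 / d₀)) - 1 / Real.sqrt (Real.log (1 / d))) *
      (Real.log (1 / d₀) / 2 + 7 / 2) =
      Real.sqrt (Real.log (1 / d₀)) / 2 + 7 / 2 * (1 / Real.sqrt (Real.log (1 / d₀)))
        - Real.log (1 / d₀) / Real.sqrt (Real.log (1 / d)) / 2
        - 7 / 2 * (1 / Real.sqrt (Real.log (1 / d))) := by
    have e : (1 / Real.sqrt (Real.log (1 / d₀)) - 1 / Real.sqrt (Real.log (1 / d))) *
        (Real.log (1 / d₀) / 2 + 7 / 2) =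
        Real.log (1 / d₀) / Real.sqrt (Real.log (1 / d₀)) / 2
          + 7 / 2 * (1 / Real.sqrt (Real.log (1 / d₀)))
          - Real.log (1 / d₀) / Real.sqrt (Real.log (1 / d)) / 2
          - 7 / 2 * (1 / Real.sqrt (Real.log (1 / d))) := by
      ring
    rw [e, Real.div_sqrt]
  exact hP1.trans_eq hP2

/-- The inner pull in the case `d₀ < 2d`: `J ≤ (d₀ − d)/(4 d L₀^{3/2}) ≤ ¼`. -/
theorem stub_surplusCalculus_pull₂ {d d₀ : ℝ} (hd : 0 < d) (hdd₀ : d < d₀) (h2d : d₀ < 2 * d)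
    (hd₀ : d₀ < 1) (hL₀ : 1 ≤ Real.log (1 / d₀)) :
    (∫ s in (0 : ℝ)..(d₀ - d),
        (1 / Real.sqrt (Real.log (1 / (d + s))) - 1 / Real.sqrt (Real.log (1 / d))) / (2 * s)) ≤
      1 / 4 := by
  have hL₀pos : 0 < Real.log (1 / d₀) := by linarith
  have hb1 : 1 ≤ Real.sqrt (Real.log (1 / d₀)) := Real.one_le_sqrt.2 hL₀
  have hX : 1 ≤ Real.log (1 / d₀) * Real.sqrt (Real.log (1 / d₀)) :=
    one_le_mul_of_one_le_of_one_le hL₀ hb1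
  have h := stub_surplusCalculus_head hd (sub_nonneg.2 hdd₀.le) (by linarith : d + (d₀ - d) ≤ d₀) hd₀
  calc _ ≤ (d₀ - d) / (4 * d * (Real.log (1 / d₀) * Real.sqrt (Real.log (1 / d₀)))) := h
    _ ≤ d / (4 * d * (Real.log (1 / d₀) * Real.sqrt (Real.log (1 / d₀)))) :=
        div_le_div_of_nonneg_right (by linarith) (by positivity)
    _ = 1 / (4 * (Real.log (1 / d₀) * Real.sqrt (Real.log (1 / d₀)))) := by field_simp
    _ ≤ 1 / 4 := one_div_le_one_div_of_le (by norm_num) (by linarith)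

/-- The plateau pull in the case `d₀ < 2d`: with `y = d₀ − d ≤ d`,
`1/√L₀ − 1/√L ≤ y/(2 d L₀^{3/2})` (`stub_surplusCalculus_diff_le`) and `y log(1/y) ≤ d (L + 1)`,
`L ≤ L₀ + 1`, so the plateau pull is `≤ (L + 7)/(4 L₀^{3/2}) ≤ 3`. -/
theorem stub_surplusCalculus_plateau₂ {d d₀ : ℝ} (hd : 0 < d) (hdd₀ : d < d₀) (h2d : d₀ < 2 * d)
    (hd₀ : d₀ < 1) (hL₀ : 1 ≤ Real.log (1 / d₀)) :
    (1 / Real.sqrt (Real.log (1 / d₀)) - 1 / Real.sqrt (Real.log (1 / d))) *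
        (Real.log (1 / (d₀ - d)) / 2 + 3) ≤ 3 := by
  have hd₀pos : 0 < d₀ := hd.trans hdd₀
  have hL₀pos : 0 < Real.log (1 / d₀) := by linarith
  have hLL₀ : Real.log (1 / d₀) ≤ Real.log (1 / d) :=
    Real.log_le_log (by positivity) (one_div_le_one_div_of_le hd hdd₀.le)
  have hLpos : 0 < Real.log (1 / d) := by linarith
  have hb1 : 1 ≤ Real.sqrt (Real.log (1 / d₀)) := Real.one_le_sqrt.2 hL₀
  have hA := stub_surplusCalculus_diff_le hd hdd₀.le hd₀
  have hQpos : 0 < Real.log (1 / (d₀ - d)) / 2 + 3 := by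
    have := stub_surplusCalculus_log_pos (sub_pos.2 hdd₀) (by linarith : d₀ - d < 1)
    linarith
  have hLle : Real.log (1 / d) ≤ Real.log (1 / d₀) + 1 := by
    have h1 := stub_surplusCalculus_log_sub_le hd hd₀pos
    have h2 : (d₀ - d) / d ≤ 1 := by
      rw [div_le_one hd]
      linarith
    linarith
  have hylog : (d₀ - d) * Real.log (1 / (d₀ - d)) ≤ d * (Real.log (1 / d) + 1) := by
    have hy0 : 0 < d₀ - d := sub_pos.2 hdd₀
    have hyd : d₀ - d ≤ d := by linarith
    have e : Real.log (1 / (d₀ - d)) = Real.log (d / (d₀ - d)) + Real.log (1 / d) := by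
      rw [← Real.log_mul (by positivity) (by positivity)]
      congr 1
      field_simp
    have h1 : (d₀ - d) * Real.log (d / (d₀ - d)) ≤ d := by
      calc (d₀ - d) * Real.log (d / (d₀ - d)) ≤ (d₀ - d) * (d / (d₀ - d) - 1) :=
            mul_le_mul_of_nonneg_left (Real.log_le_sub_one_of_pos (by positivity)) hy0.le
        _ = d - (d₀ - d) := by field_simp
        _ ≤ d := by linarith
    have h2 : (d₀ - d) * Real.log (1 / d) ≤ d * Real.log (1 / d) :=
      mul_le_mul_of_nonneg_right hyd hLpos.le
    rw [e, mul_add]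
    linarith
  have h6 : (Real.log (1 / d) + 1) / 2 + 3 ≤
      6 * (Real.log (1 / d₀) * Real.sqrt (Real.log (1 / d₀))) := by
    have := mul_le_mul_of_nonneg_left hb1 hL₀pos.le
    linarith
  have h7 : (d₀ - d) * (Real.log (1 / (d₀ - d)) / 2 + 3) ≤
      3 * (2 * d * (Real.log (1 / d₀) * Real.sqrt (Real.log (1 / d₀)))) := by
    calc (d₀ - d) * (Real.log (1 / (d₀ - d)) / 2 + 3)
        = (d₀ - d) * Real.log (1 / (d₀ - d)) / 2 + 3 * (d₀ - d) := by ring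
      _ ≤ d * (Real.log (1 / d) + 1) / 2 + 3 * d := by linarith
      _ = d * ((Real.log (1 / d) + 1) / 2 + 3) := by ring
      _ ≤ d * (6 * (Real.log (1 / d₀) * Real.sqrt (Real.log (1 / d₀)))) :=
          mul_le_mul_of_nonneg_left h6 hd.le
      _ = 3 * (2 * d * (Real.log (1 / d₀) * Real.sqrt (Real.log (1 / d₀)))) := by ring
  calc (1 / Real.sqrt (Real.log (1 / d₀)) - 1 / Real.sqrt (Real.log (1 / d))) *
        (Real.log (1 / (d₀ - d)) / 2 + 3)
      ≤ (d₀ - d) / (2 * d * (Real.log (1 / d₀) * Real.sqrt (Real.log (1 / d₀)))) *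
          (Real.log (1 / (d₀ - d)) / 2 + 3) :=
        mul_le_mul_of_nonneg_right hA.2 hQpos.le
    _ = (d₀ - d) * (Real.log (1 / (d₀ - d)) / 2 + 3) /
          (2 * d * (Real.log (1 / d₀) * Real.sqrt (Real.log (1 / d₀)))) := by
        rw [div_mul_eq_mul_div]
    _ ≤ 3 := by
        rw [div_le_iff₀ (by positivity)]
        exact h7

/-! ## The surplus inequality -/

/-- **Stub S1b `stub_surplusCalculus`**: the surplus of the two-scale profile is
`≥ ¼ √(log 1/d₀)`, with the explicit threshold `d₁ = exp (-1000)`. With `L = log(1/d)`,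
`L₀ = log(1/d₀)`, `W(s) = (log 1/s)^{-1/2}`: for `2d ≤ d₀` the inner pull is bounded through
`W(d+s) − W(d) ≤ s/(2 d L₀^{3/2})` on `(0, d]` and `W(d+s) ≤ W(2s)` on `[d, d₀]`
(`stub_surplusCalculus_pull₁`), the plateau pull through `log(1/(d₀−d)) ≤ L₀ + log 2`
(`stub_surplusCalculus_plateau₁`); for `d₀ < 2d` everything except the killing term
`½√L − 1/√L ≥ ½√L₀ − 1` is `O(1)` (`stub_surplusCalculus_pull₂`, `stub_surplusCalculus_plateau₂`).
Since `√L₀ ≥ √1000 > 31`, both totals exceed `¼ √L₀`. -/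
theorem stub_surplusCalculus :
    ∃ d₁ : ℝ, 0 < d₁ ∧ 2 * d₁ ≤ 1 ∧ ∀ d₀ d : ℝ, 0 < d → d < d₀ → d₀ ≤ d₁ →
      1 / 4 * Real.sqrt (Real.log (1 / d₀)) ≤
        1 / Real.sqrt (Real.log (1 / d)) * (Real.log (1 / d) / 2 - 1)
          - (∫ s in (0 : ℝ)..(d₀ - d),
              (1 / Real.sqrt (Real.log (1 / (d + s))) - 1 / Real.sqrt (Real.log (1 / d))) / (2 * s))
          - d₀ / Real.sqrt (Real.log (1 / d₀))
          - (1 / Real.sqrt (Real.log (1 / d₀)) - 1 / Real.sqrt (Real.log (1 / d))) *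
              (Real.log (1 / (d₀ - d)) / 2 + 3) := by
  have h4 : (4 : ℝ) ≤ Real.exp 1000 := by
    have := Real.add_one_le_exp (1000 : ℝ)
    linarith
  have hexp : Real.exp (-1000) ≤ 1 / 4 := by
    rw [Real.exp_neg, ← one_div]
    exact one_div_le_one_div_of_le (by norm_num) h4
  refine ⟨Real.exp (-1000), Real.exp_pos _, by linarith, ?_⟩
  intro d₀ d hd hdd₀ hd₀
  -- basic positivity and size facts
  have hd₀pos : 0 < d₀ := hd.trans hdd₀
  have hd₀half : d₀ ≤ 1 / 2 := by linarith
  have h2d₀ : 2 * d₀ < 1 := by linarith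
  have hd₀lt1 : d₀ < 1 := by linarith
  have hL₀ : 1000 ≤ Real.log (1 / d₀) := by
    have e : Real.log (1 / Real.exp (-1000)) = 1000 := by
      rw [Real.exp_neg, one_div, inv_inv, Real.log_exp]
    calc (1000 : ℝ) = Real.log (1 / Real.exp (-1000)) := e.symm
      _ ≤ Real.log (1 / d₀) :=
        Real.log_le_log (by positivity) (one_div_le_one_div_of_le hd₀pos hd₀)
  have hL₀1 : 1 ≤ Real.log (1 / d₀) := by linarith
  have hLL₀ : Real.log (1 / d₀) ≤ Real.log (1 / d) :=
    Real.log_le_log (by positivity) (one_div_le_one_div_of_le hd hdd₀.le)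
  have hb31 : 31 ≤ Real.sqrt (Real.log (1 / d₀)) := by
    rw [Real.le_sqrt' (by norm_num)]
    linarith
  have hbpos : 0 < Real.sqrt (Real.log (1 / d₀)) := by linarith
  have hb1 : 1 ≤ Real.sqrt (Real.log (1 / d₀)) := by linarith
  have hab : Real.sqrt (Real.log (1 / d₀)) ≤ Real.sqrt (Real.log (1 / d)) := Real.sqrt_le_sqrt hLL₀
  have hapos : 0 < Real.sqrt (Real.log (1 / d)) := by linarith
  -- the killing term `K = √L/2 − 1/√L`
  have hK : 1 / Real.sqrt (Real.log (1 / d)) * (Real.log (1 / d) / 2 - 1) =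
      Real.sqrt (Real.log (1 / d)) / 2 - 1 / Real.sqrt (Real.log (1 / d)) := by
    calc 1 / Real.sqrt (Real.log (1 / d)) * (Real.log (1 / d) / 2 - 1)
        = Real.log (1 / d) / Real.sqrt (Real.log (1 / d)) / 2 - 1 / Real.sqrt (Real.log (1 / d)) := by
          ring
      _ = _ := by rw [Real.div_sqrt]
  have hA3 : 0 ≤ 1 / Real.sqrt (Real.log (1 / d)) := by positivity
  have hA3le : 1 / Real.sqrt (Real.log (1 / d)) ≤ 1 := by
    rw [div_le_one hapos]
    linarith
  have hA4le : 1 / Real.sqrt (Real.log (1 / d₀)) ≤ 1 := by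
    rw [div_le_one hbpos]
    linarith
  -- the tiny term `β₀ d₀ ≤ 1/2`
  have hT : d₀ / Real.sqrt (Real.log (1 / d₀)) ≤ 1 / 2 := (div_le_self hd₀pos.le hb1).trans hd₀half
  rcases le_or_gt (2 * d) d₀ with h2d | h2d
  · /- Case `2d ≤ d₀`. -/
    have hJ := stub_surplusCalculus_pull₁ hd h2d h2d₀ hL₀1
    have hP := stub_surplusCalculus_plateau₁ hd h2d hd₀lt1
    linarith
  · /- Case `d₀ < 2d`. -/
    have hJ := stub_surplusCalculus_pull₂ hd hdd₀ h2d hd₀lt1 hL₀1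
    have hP := stub_surplusCalculus_plateau₂ hd hdd₀ h2d hd₀lt1 hL₀1
    linarith

end Summit.RiemannHypothesis.RiemannHypothesis.Theorems.WeilWindowFlowWindowLipschitz

end
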